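import Summits.CriticalPhenomena.PercolationContinuityZ3.Theorems.Transplant.FKThreeApexOmega

/-!
# Connectivity correlation inequalities for `φ_{w,q}`, `0 < q ≤ 1` — the three-apex monoid of `K_{1,1,1,n}`:
# the UPPER ENVELOPE ("cap") inequalities `v̂ û³ ≤ x̂ ŷ ẑ ((1−q) û + q x̂)` and their `S₃`-images

Helper file (`--supports stmt-CriticalPhenomena-4575`), FK sub-lane `prim-bschramm-fk-3` (gen 15); builds on p205010 (kernel theorem,
internal audit signed; external expert review pending).  Pure real algebra: no measures, no named facts, no sorries; standard axioms.

In hat coordinates `(û, x̂, ŷ, ẑ, v̂) = (Z_0, Z_0+Z_ab, Z_0+Z_ac, Z_0+Z_bc, |Z|)` of the three-apex monoid `InK q` (products are coordinatewise,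
`hat_conv`), the files `FKThreeApexAlgebra` … `FKThreeApexOmegaClosure2` give LOWER and lateral envelope information (`(S)`, `Λ ≥ 0`, the master
inequalities, `Ω_q`).  The quadratic forms of the last open pair type T3 (`FKThreeApexT3Form`) are NOT non-negative on `Ω_a ∩ Ω_b ∩ Ω_c`
(memo `DISJOINT-VIA-U.md` §4.3: exact counterexamples on rays `v̂ → ∞`): an UPPER bound on `v̂` in terms of `û, x̂, ŷ, ẑ` is missing there.
This file supplies it.  With `A = x̂/û, B = ŷ/û, C = ẑ/û, V = v̂/û`:
* **`InK.capA_nonneg`** — `V ≤ A·B·C·(1 + q(A − 1))`, i.e. `capA q Z = x̂ŷẑ((1−q)û + q x̂) − v̂û³ ≥ 0` on `InK q`, `0 ≤ q ≤ 1`;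
  `InK.capB_nonneg`, `InK.capC_nonneg` — the images under `b ↔ c`, `a ↔ c`.
The proof is Theorem-M-like: the set `{cap ≥ 0, x̂ ≥ û ≥ 0}` is closed under coordinatewise products by the exact identity `capA_conv`
(`cap(zZ) = cap(Z)·x'y'z'((1−q)u'+qx') + v̂û³·cap(z) + q(1−q)·x̂ŷẑ·x'y'z'·(x̂−û)(x'−u')`, using `(1−q)+q = 1`), and every letter satisfies it
(`IsLetter.capA_nonneg`: for a leaf `cap = û·(abc)²·āb̄c̄ + q·ab c̄·[x̂ŷ(qāb̄c̄ + ab̄c̄ + ābc̄ + ābc) + āb̄c(û(Z_ab+Z_ac) + Z_abZ_ac)]`).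
For letters the excess `V/(ABC) − 1` is `O(q)` and vanishes when any leaf probability is `0` or `1`; the cap is tight on the faces `A = 1`
(there `V = BC` on the monoid) and is the polynomial, multiplicatively closed relaxation `t ↦ t(1+q(t−1))` of the exact monoid envelope
`V ≤ (ABC)^{1+O(q)}` (memo `T3-VIA-CAP.md`, gen 15).
[cite: Grimmett2006, §3.9 eq. (3.94) (pp. 63–64)] [folklore]
-/

noncomputable section

namespace Summit.CriticalPhenomena.PercolationContinuityZ3.Theorems

namespace FK

namespace ThreeApex

/-! ### The cap forms -/

/-- The cap form for the block `ab`: `x̂ŷẑ((1−q)û + q x̂) − v̂ û³` (`≥ 0` ⟺ `V ≤ ABC(1+q(A−1))` in ratio coordinates). [folklore] -/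
def capA (q : ℝ) (Z : V5) : ℝ :=
  hx Z * hy Z * hz Z * ((1 - q) * Z.z0 + q * hx Z) - Z.total * Z.z0 ^ 3

/-- The cap form for the block `ac`: `x̂ŷẑ((1−q)û + q ŷ) − v̂ û³`. [folklore] -/
def capB (q : ℝ) (Z : V5) : ℝ :=
  hx Z * hy Z * hz Z * ((1 - q) * Z.z0 + q * hy Z) - Z.total * Z.z0 ^ 3

/-- The cap form for the block `bc`: `x̂ŷẑ((1−q)û + q ẑ) − v̂ û³`. [folklore] -/
def capC (q : ℝ) (Z : V5) : ℝ :=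
  hx Z * hy Z * hz Z * ((1 - q) * Z.z0 + q * hz Z) - Z.total * Z.z0 ^ 3

/-- `capA` of the `b ↔ c` relabelling is `capB`. [folklore] -/
theorem capA_swapBC (q : ℝ) (Z : V5) : capA q (swapBC Z) = capB q Z := by
  simp only [capA, capB, swapBC, hx, hy, hz, V5.total]; ring

/-- `capA` of the relabelling `Z ↦ swapBC (swapAB Z)` (which moves the block `bc` to the `x̂`-slot) is `capC`. [folklore] -/
theorem capA_swapBC_swapAB (q : ℝ) (Z : V5) : capA q (swapBC (swapAB Z)) = capC q Z := by
  simp only [capA, capC, swapBC, swapAB, hx, hy, hz, V5.total]; ring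

/-! ### The product identity -/

/-- **Product identity for the cap form.** For all `z, Z`:
`capA(zZ) = capA(Z)·x'y'z'((1−q)u'+qx') + v̂û³·capA(z) + q(1−q)·(x'y'z')(x̂ŷẑ)(x'−u')(x̂−û)` (primes = hat coordinates of `z`);
the key step is `(1−q)uu' + q xx' = ((1−q)u+qx)((1−q)u'+qx') + q(1−q)(x−u)(x'−u')`. [folklore] -/
theorem capA_conv (q : ℝ) (z Z : V5) :
    capA q (conv z Z) = capA q Z * (hx z * hy z * hz z * ((1 - q) * z.z0 + q * hx z))
      + Z.total * Z.z0 ^ 3 * capA q z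
      + q * (1 - q) * (hx z * hy z * hz z) * (hx Z * hy Z * hz Z) * (hx z - z.z0) * (hx Z - Z.z0) := by
  simp only [capA, conv, hx, hy, hz, V5.total]; ring

/-! ### Letters -/

/-- Every letter satisfies the cap inequality (`0 ≤ q ≤ 1`): for a leaf
`capA = û(abc)²āb̄c̄ + q·abc̄·[x̂ŷ(qāb̄c̄+ab̄c̄+ābc̄+ābc) + āb̄c(û(Z_ab+Z_ac)+Z_abZ_ac)]`; for the edge `ab` it is `q w (1−w)²`,
for the edges `ac`, `bc` it vanishes. [folklore] -/
theorem IsLetter.capA_nonneg {q : ℝ} (hq0 : 0 ≤ q) (hq1 : q ≤ 1) {z : V5} (h : IsLetter q z) : 0 ≤ capA q z := by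
  have hq' : (0 : ℝ) ≤ 1 - q := sub_nonneg.2 hq1
  rcases h with ⟨ha0, ha1, hb0, hb1, hc0, hc1⟩ | ⟨hw0, hw1⟩ | ⟨hw0, hw1⟩ | ⟨hw0, hw1⟩
  · rename_i a b c
    have ha' : (0 : ℝ) ≤ 1 - a := sub_nonneg.2 ha1
    have hb' : (0 : ℝ) ≤ 1 - b := sub_nonneg.2 hb1
    have hc' : (0 : ℝ) ≤ 1 - c := sub_nonneg.2 hc1
    have e : capA q (ThreeApex.leaf q a b c) =
        (q * (1 - a) * (1 - b) * (1 - c) + a * (1 - b) * (1 - c) + (1 - a) * b * (1 - c) + (1 - a) * (1 - b) * c)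
            * (a * b * c) ^ 2 * ((1 - a) * (1 - b) * (1 - c))
          + q * (a * b * (1 - c)) *
            ((q * (1 - a) * (1 - b) * (1 - c) + a * (1 - b) * (1 - c) + (1 - a) * b * (1 - c) + (1 - a) * (1 - b) * c
                + a * b * (1 - c))
              * (q * (1 - a) * (1 - b) * (1 - c) + a * (1 - b) * (1 - c) + (1 - a) * b * (1 - c) + (1 - a) * (1 - b) * c
                + a * (1 - b) * c)
              * (q * ((1 - a) * (1 - b) * (1 - c)) + a * (1 - b) * (1 - c) + (1 - a) * b * (1 - c) + (1 - a) * b * c)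
             + (1 - a) * (1 - b) * c *
              ((q * (1 - a) * (1 - b) * (1 - c) + a * (1 - b) * (1 - c) + (1 - a) * b * (1 - c) + (1 - a) * (1 - b) * c)
                  * (a * b * (1 - c) + a * (1 - b) * c)
                + a * b * (1 - c) * (a * (1 - b) * c))) := by
      simp only [capA, hx, hy, hz, V5.total, ThreeApex.leaf]; ring
    rw [e]; positivity
  · rename_i w
    have hw' : (0 : ℝ) ≤ 1 - w := sub_nonneg.2 hw1
    have e : capA q (ThreeApex.edgeAB w) = q * w * (1 - w) ^ 2 := by
      simp only [capA, hx, hy, hz, V5.total, ThreeApex.edgeAB]; ring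
    rw [e]; positivity
  · rename_i w
    have e : capA q (ThreeApex.edgeAC w) = 0 := by
      simp only [capA, hx, hy, hz, V5.total, ThreeApex.edgeAC]; ring
    rw [e]
  · rename_i w
    have e : capA q (ThreeApex.edgeBC w) = 0 := by
      simp only [capA, hx, hy, hz, V5.total, ThreeApex.edgeBC]; ring
    rw [e]

/-! ### The monoid -/

/-- **THE CAP INEQUALITY (block `ab`).** `x̂ŷẑ((1−q)û + q x̂) ≥ v̂ û³` on the three-apex monoid, `0 ≤ q ≤ 1`; i.e. the ratio
`V = v̂/û` is at most `ABC·(1 + q(A−1))` (`A = x̂/û`, …) — an upper envelope of the monoid missing from `Ω_a ∩ Ω_b ∩ Ω_c`. [folklore] -/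
theorem InK.capA_nonneg {q : ℝ} (hq0 : 0 ≤ q) (hq1 : q ≤ 1) {Z : V5} (h : InK q Z) : 0 ≤ capA q Z := by
  have hq' : (0 : ℝ) ≤ 1 - q := sub_nonneg.2 hq1
  induction h with
  | base => simp [capA, hx, hy, hz, V5.total, delta0]
  | @step z Z hl hZ ih =>
    obtain ⟨h0, h1, h2, h3, h4⟩ := hZ.nonneg hq0
    obtain ⟨g0, g1, g2, g3, g4⟩ := hl.nonneg hq0
    have gt : 0 ≤ z.total := V5.Nonneg.total ⟨g0, g1, g2, g3, g4⟩
    have ht : 0 ≤ Z.total := V5.Nonneg.total ⟨h0, h1, h2, h3, h4⟩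
    have gc : 0 ≤ capA q z := hl.capA_nonneg hq0 hq1
    have ex : 0 ≤ hx z := by simp only [hx]; positivity
    have ey : 0 ≤ hy z := by simp only [hy]; positivity
    have ez : 0 ≤ hz z := by simp only [hz]; positivity
    have eX : 0 ≤ hx Z := by simp only [hx]; positivity
    have eY : 0 ≤ hy Z := by simp only [hy]; positivity
    have eZ : 0 ≤ hz Z := by simp only [hz]; positivity
    have dx : 0 ≤ hx z - z.z0 := by simp only [hx]; linarith
    have dX : 0 ≤ hx Z - Z.z0 := by simp only [hx]; linarith
    rw [capA_conv]
    positivity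

/-- **THE CAP INEQUALITY (block `ac`).** `x̂ŷẑ((1−q)û + q ŷ) ≥ v̂ û³` on the three-apex monoid, `0 ≤ q ≤ 1`. [folklore] -/
theorem InK.capB_nonneg {q : ℝ} (hq0 : 0 ≤ q) (hq1 : q ≤ 1) {Z : V5} (h : InK q Z) : 0 ≤ capB q Z := by
  rw [← capA_swapBC]; exact h.swapBC.capA_nonneg hq0 hq1

/-- **THE CAP INEQUALITY (block `bc`).** `x̂ŷẑ((1−q)û + q ẑ) ≥ v̂ û³` on the three-apex monoid, `0 ≤ q ≤ 1`. [folklore] -/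
theorem InK.capC_nonneg {q : ℝ} (hq0 : 0 ≤ q) (hq1 : q ≤ 1) {Z : V5} (h : InK q Z) : 0 ≤ capC q Z := by
  rw [← capA_swapBC_swapAB]; exact h.swapAB.swapBC.capA_nonneg hq0 hq1

/-- Ratio form of the three caps: `v̂ û³ ≤ x̂ŷẑ((1−q)û + q·m̂)` for each `m̂ ∈ {x̂, ŷ, ẑ}`, hence with `m̂ = min`. [folklore] -/
theorem InK.total_mul_cube_le {q : ℝ} (hq0 : 0 ≤ q) (hq1 : q ≤ 1) {Z : V5} (h : InK q Z) :
    Z.total * Z.z0 ^ 3 ≤ hx Z * hy Z * hz Z * ((1 - q) * Z.z0 + q * hx Z) ∧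
      Z.total * Z.z0 ^ 3 ≤ hx Z * hy Z * hz Z * ((1 - q) * Z.z0 + q * hy Z) ∧
      Z.total * Z.z0 ^ 3 ≤ hx Z * hy Z * hz Z * ((1 - q) * Z.z0 + q * hz Z) := by
  refine ⟨?_, ?_, ?_⟩
  · have := h.capA_nonneg hq0 hq1; simp only [capA] at this; linarith
  · have := h.capB_nonneg hq0 hq1; simp only [capB] at this; linarith
  · have := h.capC_nonneg hq0 hq1; simp only [capC] at this; linarith

end ThreeApex

end FK

end Summit.CriticalPhenomena.PercolationContinuityZ3.Theorems
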